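import Mathlib
import HarnessLib
import Summits.ValiantsHypothesis.ValiantsHypothesis.Theorems.SchenstedIndexBorderPcPerThreeGeom

/-!
# Route SchenstedIndex — a polynomial separating `per_3` from all width-3 power traces
# (step (a) of the completeness transfer for `BorderPcPerThree`, stmt-ValiantsHypothesis-16085)

From `perPoly_three_not_mem_orbitClosure_tracePow_three` (`per_3 ∉ Δ(tr X_3³)`): there is a polynomial
`p` on the coefficient space of `ℂ[x_(i,j)]` which VANISHES at the coefficient vector of `tr(A_M³)` for
EVERY label-consistent pencil `A_M = ∑_ℓ x_ℓ M_ℓ` (`M : Fin 3 × Fin 3 → M_3(ℂ)`; these are exactly the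
width-3 power-trace representations, all lying in the endomorphism orbit `End(ℂ⁹)·tr X³ ⊆ Δ(tr X³)`)
and does NOT vanish at the coefficient vector of `per_3` (`exists_separating_polynomial_perPoly_three`).
The remaining steps of the blueprint (torus-weight component, padding to weight `t·J`, translation into
a functional on block partitions, symmetrisation; then the landed polarisation / rank-one / count-vector
lemmas) turn such a `p` into a witness `t` with `1_OF(t,3) ∉ span_3(t,3)`.

HONEST FRAMING: bookkeeping for an OPEN support item; nothing here bears on `VP ≠ VNP`.
-/

set_option linter.dupNamespace false

noncomputable section

namespace Summit.ValiantsHypothesis.ValiantsHypothesis.Theorems.SchenstedIndex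

open MvPolynomial Matrix
open Literature.Computability.AlgebraicComplexity

/-- Every label-consistent pencil cube trace `tr(A_M³)`, `A_M = ∑_ℓ x_ℓ M_ℓ`, lies in the endomorphism
orbit of `tr(X³)` (it is the linear substitution `x_(a,b) ↦ (A_M)_(a,b)`). -/
theorem tracePow_pencil_mem_endOrbit {n : ℕ} (M : Fin n × Fin n → Matrix (Fin n) (Fin n) ℂ) :
    ((Matrix.of fun a b : Fin n => ∑ ℓ : Fin n × Fin n,
        C (M ℓ a b) * (X ℓ : MvPolynomial (Fin n × Fin n) ℂ)) ^ 3).trace ∈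
      endOrbit (Fin n × Fin n) ℂ ((Matrix.mvPolynomialX (Fin n) (Fin n) ℂ ^ 3).trace) := by
  refine ⟨fun v p => M v p.1 p.2, ?_⟩
  have hlin : linSubst (Fin n × Fin n) ℂ (fun v p => M v p.1 p.2) =
      aeval (fun p : Fin n × Fin n => (Matrix.of fun a b : Fin n => ∑ ℓ : Fin n × Fin n,
        C (M ℓ a b) * (X ℓ : MvPolynomial (Fin n × Fin n) ℂ)) p.1 p.2) := by
    unfold linSubst
    congr 1
    funext p
    rw [Matrix.of_apply]
    refine Finset.sum_congr rfl fun v _ => ?_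
    rw [smul_eq_C_mul]
  change linSubst (Fin n × Fin n) ℂ (fun v p => M v p.1 p.2)
      ((Matrix.mvPolynomialX (Fin n) (Fin n) ℂ ^ 3).trace) = _
  rw [hlin, AddMonoidHom.map_trace, ← AlgHom.mapMatrix_apply, map_pow,
    Matrix.mvPolynomialX_mapMatrix_aeval]

/-- **A polynomial separating `per_3` from the width-3 power traces** (step (a) of the completeness
transfer): some polynomial on coefficient space vanishes at `coeffVec (tr A_M³)` for every
label-consistent pencil `A_M` and not at `coeffVec per_3`. -/
theorem exists_separating_polynomial_perPoly_three :
    ∃ p : MvPolynomial ((Fin 3 × Fin 3) →₀ ℕ) ℂ,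
      (∀ M : Fin 3 × Fin 3 → Matrix (Fin 3) (Fin 3) ℂ,
        aeval (coeffVec ((Matrix.of fun a b : Fin 3 => ∑ ℓ : Fin 3 × Fin 3,
          C (M ℓ a b) * (X ℓ : MvPolynomial (Fin 3 × Fin 3) ℂ)) ^ 3).trace) p = 0) ∧
      aeval (coeffVec (perPoly (Fin 3) ℂ)) p ≠ 0 := by
  have h := perPoly_three_not_mem_orbitClosure_tracePow_three
  rw [mem_orbitClosure_iff] at h
  push Not at h
  obtain ⟨p, hp, hper⟩ := h
  refine ⟨p, fun M => ?_, hper⟩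
  have hmem : ((Matrix.of fun a b : Fin 3 => ∑ ℓ : Fin 3 × Fin 3,
      C (M ℓ a b) * (X ℓ : MvPolynomial (Fin 3 × Fin 3) ℂ)) ^ 3).trace ∈
      orbitClosure ((Matrix.mvPolynomialX (Fin 3) (Fin 3) ℂ ^ 3).trace) :=
    endOrbit_subset_orbitClosure_holds _ (tracePow_pencil_mem_endOrbit M)
  exact (mem_orbitClosure_iff.1 hmem) p hp

end Summit.ValiantsHypothesis.ValiantsHypothesis.Theorems.SchenstedIndex

end
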